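import Summits.MatrixMultiplication.MatrixMultiplication.Theses.MarginalColumns
import Summits.MatrixMultiplication.MatrixMultiplication.Theorems.SecondColumnDominates.Negative.LoadBearing
import Literature.Computability.AlgebraicComplexity.BorderRankMatMulTwoHolds
import Literature.Computability.AlgebraicComplexity.BorderRankMatMulSmall223Proofs
import Literature.Computability.AlgebraicComplexity.BorderRankMatMulSmallProofs
import Literature.Computability.AlgebraicComplexity.CoppersmithWinograd1982Crude

/-!
# Line `Sketch` (koszul-pivot-split) — skeleton for the crux `SecondColumnDominates`
# (stmt-MatrixMultiplication-16310, route `MarginalColumns`)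

Crux (FIXED; route decl
`Summit.MatrixMultiplication.MatrixMultiplication.Theses.MarginalColumns.SecondColumnDominates`).
With `T n w := R̲⟨n,n,w⟩ = algBorderRank (matMulTensor ℂ n n w)` (the COLUMN TOWER of the square
format) it reads `D : ∀ n w ≥ 1, T n (w+1) + T n 1 ≤ T n w + T n 2`.

## Line: the Koszul pivot `2n − 1`

The constant `2n − 1` — the slope of the Landsberg–Ottaviani column bound `(2n−1)·w ≤ T n w`
(Landsberg 2017, Thm. 2.5.2.6; the tree proves the square case
`LandsbergOttaviani2015_algBorderRank_matMulTensor` and the `p = 1` rectangular case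
`three_mul_mul_le_two_mul_algBorderRank_matMulTensor`) — separates the two unknowns that D
compares:

* `stub_columnStepSquare` — the SQUARE COLUMN STEP `T n (w+1) ≤ T n w + (2n − 1)` for all
  `n, w ≥ 1` (a pure UPPER bound with a constant cap; = `HollowSchoolbook.ColumnStep` at `a = b`;
  first open cell `(3,2)`: `R̲⟨3,3,3⟩ ≤ 14 + 5 = 19`, the existing item
  stmt-MatrixMultiplication-8008, window `[17, 20]`, both ends PROVED in tree).
* `stub_secondColumnFloor` — the SECOND-COLUMN FLOOR `n² + 2n − 1 ≤ T n 2` for all `n ≥ 1`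
  (a pure LOWER bound; cells `n ≤ 2` are tree theorems, `n = 3` is CHL 2023 Thm 1.4 rotated,
  `n = 4` is the printed-open census `⟨2,4,4⟩ @ 22`, all `n` a CHL Thm 1.4(3)-type analysis with
  constant `2` instead of `3√6 − 6`). It is ZERO-RISK for the crux: D itself forces it, given the
  rectangular Landsberg–Ottaviani slope (refuter probe W1b on the item).

COMPOSITION (`dominates_of_step_floor`, sorry-free, `omega` over
`Negative.algBorderRank_matMulTensor_sq_one : T n 1 = n·n`):
`T n (w+1) + n² ≤ T n w + (2n−1) + n² ≤ T n w + T n 2`.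
`SecondColumnDominates_of` is the unique theorem concluding the crux BY NAME; the only `sorry`s of
the file are the two stubs.

Honest scope: the conjunction of the stubs is STRONGER than D by exactly
`HollowSchoolbook.TwoColumns` (`T n 2 ≤ n² + 2n − 1`); both stubs are open in print beyond their
first cells (lead's census in the session NOTES / HANDOFF).

Disproof used: none yet — `Cruxes/SecondColumnDominates/Disproof.lean` does not exist at
registration (2026-08-17T11:40Z); the landed `Theorems/SecondColumnDominates/Negative/LoadBearing.lean`
(p146187) is honoured: the composition USES `1 ≤ w` through the stubs' binders and the value
`T n 1 = n·n`, and the tight cell `(2,2)` is the step's equality case `10 = 7 + 3`.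

Lead: prover-line-stmt-MatrixMultiplication-16310-0 (line `Sketch`, 2026-08-17).
-/

set_option linter.dupNamespace false

namespace Summit.MatrixMultiplication.MatrixMultiplication.Cruxes.SecondColumnDominates.Sketch

open Literature.Computability.AlgebraicComplexity
open Summit.MatrixMultiplication.MatrixMultiplication.Theorems.SecondColumnDominates

/-- **Stub 1 — the square column step.** For `n, w ≥ 1`:
`R̲⟨n,n,w+1⟩ + 1 ≤ R̲⟨n,n,w⟩ + 2n`, i.e. a new column of the `n × n` by `n × w` format costs at
most the hook `2n − 1` in the border limit. `HollowSchoolbook.ColumnStep` at `a = b = n − 1`.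
Cells known: `(n,1)` for `n ≤ 3` (`7 = 4 + 3`, `14 = 9 + 5`), `(2,2)` (`10 ≤ 7 + 3`, BCLR 1979),
`(2,w)` for `w ≤ 6` modulo the printed `R̲⟨2,2,w+1⟩ ≤ 3w + 4` (Smirnov) and `3w ≤ R̲⟨2,2,w⟩`;
first open cell `(3,2)` = `R̲⟨3,3,3⟩ ≤ 19` (stmt-MatrixMultiplication-8008).
[cite: LandsbergGCT2017, §4.8] [cite: ConnerHarperLandsberg2023, Thm. 1.1, 1.3, 1.4] -/
theorem stub_columnStepSquare :
    ∀ n w : ℕ, 1 ≤ n → 1 ≤ w →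
      Literature.Computability.AlgebraicComplexity.algBorderRank
          (Literature.Computability.AlgebraicComplexity.matMulTensor ℂ n n (w + 1)) + 1 ≤
        Literature.Computability.AlgebraicComplexity.algBorderRank
          (Literature.Computability.AlgebraicComplexity.matMulTensor ℂ n n w) + 2 * n := by
  sorry

/-- **Stub 2 — the second-column floor.** For `n ≥ 1`: `n·n + 2n ≤ R̲⟨n,n,2⟩ + 1`, i.e.
`R̲⟨n,n,2⟩ ≥ n² + 2n − 1` (the first marginal of the column tower is at least the Koszul slope
`2n − 1`). Cells known: `n = 1` (`2`), `n = 2` (`7`, Landsberg 2006, PROVED in tree as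
`algBorderRank_matMulTensor_two`), `n = 3` (`14`, CHL 2023 Thm 1.4, named fact
`ConnerHarperLandsberg2023_thm_1_4_233` rotated); `n = 4` asks `R̲⟨4,4,2⟩ ≥ 23` (printed `≥ 22`,
CHL Thm 1.4(2)); all `n`: CHL Thm 1.4(3) gives `n² + 1.32n + 1` for `n ≥ 25`.
[cite: ConnerHarperLandsberg2023, Thm. 1.4] [cite: LandsbergOttaviani2015, Thm. 2.1] -/
theorem stub_secondColumnFloor :
    ∀ n : ℕ, 1 ≤ n →
      n * n + 2 * n ≤
        Literature.Computability.AlgebraicComplexity.algBorderRank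
          (Literature.Computability.AlgebraicComplexity.matMulTensor ℂ n n 2) + 1 := by
  sorry

/-- **Composition with explicit signatures (kernel-checked, no sorry): step and floor give the
crux's defining statement verbatim.** `T n (w+1) + T n 1 = T n (w+1) + n² ≤ T n w + 2n − 1 + n²
≤ T n w + T n 2`. (The result type is the BODY of `MarginalColumns.SecondColumnDominates`, so that
`SecondColumnDominates_of` below is the file's only theorem concluding the crux by name.)
[cite: LandsbergGCT2017, §4.8] -/
theorem dominates_of_step_floor
    (hstep : ∀ n w : ℕ, 1 ≤ n → 1 ≤ w →
      Literature.Computability.AlgebraicComplexity.algBorderRank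
          (Literature.Computability.AlgebraicComplexity.matMulTensor ℂ n n (w + 1)) + 1 ≤
        Literature.Computability.AlgebraicComplexity.algBorderRank
          (Literature.Computability.AlgebraicComplexity.matMulTensor ℂ n n w) + 2 * n)
    (hfloor : ∀ n : ℕ, 1 ≤ n →
      n * n + 2 * n ≤
        Literature.Computability.AlgebraicComplexity.algBorderRank
          (Literature.Computability.AlgebraicComplexity.matMulTensor ℂ n n 2) + 1) :
    ∀ n w : ℕ, 1 ≤ n → 1 ≤ w →
      Literature.Computability.AlgebraicComplexity.algBorderRank
          (Literature.Computability.AlgebraicComplexity.matMulTensor ℂ n n (w + 1)) +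
        Literature.Computability.AlgebraicComplexity.algBorderRank
          (Literature.Computability.AlgebraicComplexity.matMulTensor ℂ n n 1) ≤
      Literature.Computability.AlgebraicComplexity.algBorderRank
          (Literature.Computability.AlgebraicComplexity.matMulTensor ℂ n n w) +
        Literature.Computability.AlgebraicComplexity.algBorderRank
          (Literature.Computability.AlgebraicComplexity.matMulTensor ℂ n n 2) := by
  intro n w hn hw
  have h1 : algBorderRank (matMulTensor ℂ n n 1) = n * n :=
    Negative.algBorderRank_matMulTensor_sq_one n
  have hs := hstep n w hn hw
  have hf := hfloor n hn
  omega

/-- **THE SKELETON THEOREM — the crux `SecondColumnDominates` BY NAME from the two declared stubs**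
(`sorry` occurs only inside `stub_columnStepSquare` and `stub_secondColumnFloor`; the term is the
sorry-free composition `dominates_of_step_floor` applied to them). [cite: LandsbergGCT2017, §4.8] -/
theorem SecondColumnDominates_of :
    Summit.MatrixMultiplication.MatrixMultiplication.Theses.MarginalColumns.SecondColumnDominates := by
  unfold Summit.MatrixMultiplication.MatrixMultiplication.Theses.MarginalColumns.SecondColumnDominates
  exact dominates_of_step_floor stub_columnStepSquare stub_secondColumnFloor

/-! ## What is already decided (sorry-free cells, from tree theorems only) -/

/-- Step cell `(n, w) = (2, 1)`: `R̲⟨2,2,2⟩ + 1 ≤ R̲⟨2,2,1⟩ + 4`, i.e. `7 + 1 ≤ 4 + 4`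
(Strassen / Landsberg 2006, `algBorderRank_matMulTensor_two`, PROVED in tree). [folklore] -/
theorem step_cell_two_one :
    algBorderRank (matMulTensor ℂ 2 2 (1 + 1)) + 1 ≤ algBorderRank (matMulTensor ℂ 2 2 1) + 2 * 2 := by
  have h7 : algBorderRank (matMulTensor ℂ 2 2 2) = 7 := algBorderRank_matMulTensor_two ℂ
  have h4 := Negative.algBorderRank_matMulTensor_sq_one 2
  simp only [Nat.reduceAdd]
  omega

/-- Step cell `(n, w) = (2, 2)`: `R̲⟨2,2,3⟩ + 1 ≤ R̲⟨2,2,2⟩ + 4`, i.e. `10 + 1 ≤ 7 + 4`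
(Bini–Capovani–Romani–Lotti 1979 `≤ 10`, PROVED in tree; `= 7` PROVED in tree). The step's
EQUALITY case. [cite: BiniCapovaniRomaniLotti1979, main result (via BCS §15.2)] -/
theorem step_cell_two_two :
    algBorderRank (matMulTensor ℂ 2 2 (2 + 1)) + 1 ≤ algBorderRank (matMulTensor ℂ 2 2 2) + 2 * 2 := by
  have h10 : algBorderRank (matMulTensor ℂ 2 2 3) ≤ 10 := BCRL1979_algBorderRank_matMulTensor_223_le ℂ
  have h7 : algBorderRank (matMulTensor ℂ 2 2 2) = 7 := algBorderRank_matMulTensor_two ℂ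
  simp only [Nat.reduceAdd]
  omega

/-- Floor cell `n = 2`: `2·2 + 2·2 ≤ R̲⟨2,2,2⟩ + 1 = 8` (Landsberg 2006, PROVED in tree). [folklore] -/
theorem floor_cell_two : 2 * 2 + 2 * 2 ≤ algBorderRank (matMulTensor ℂ 2 2 2) + 1 := by
  have h7 : algBorderRank (matMulTensor ℂ 2 2 2) = 7 := algBorderRank_matMulTensor_two ℂ
  omega

/-- Floor cell `n = 1`: `1 + 2 ≤ R̲⟨1,1,2⟩ + 1 = 3`. [folklore] -/
theorem floor_cell_one : 1 * 1 + 2 * 1 ≤ algBorderRank (matMulTensor ℂ 1 1 2) + 1 := by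
  have h := Negative.algBorderRank_matMulTensor_one_one 2
  omega

/-- Step cell `(n, w) = (3, 1)`: `R̲⟨3,3,2⟩ + 1 ≤ R̲⟨3,3,1⟩ + 6`, i.e. `14 + 1 ≤ 9 + 6`
(Smirnov 2013 `R̲⟨3,3,2⟩ ≤ 14`, PROVED in tree from his `⟨3,2,3; 14⟩` table; `R̲⟨3,3,1⟩ = 9`).
The step's EQUALITY case at `n = 3` modulo CHL 2023 Thm 1.4. [cite: Smirnov2013, Table 4] -/
theorem step_cell_three_one :
    algBorderRank (matMulTensor ℂ 3 3 (1 + 1)) + 1 ≤ algBorderRank (matMulTensor ℂ 3 3 1) + 2 * 3 := by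
  have h14 : algBorderRank (matMulTensor ℂ 3 3 2) ≤ 14 := Smirnov2013_algBorderRank_matMulTensor_332_le ℂ
  have h9 := Negative.algBorderRank_matMulTensor_sq_one 3
  simp only [Nat.reduceAdd]
  omega

/-- **The first OPEN cell `(3, 2)` of the step stub is at least `CubeNineteen`:** the step at
`(3,2)` reads `R̲⟨3,3,3⟩ + 1 ≤ R̲⟨3,3,2⟩ + 6 ≤ 20` (Smirnov's `R̲⟨3,3,2⟩ ≤ 14`), i.e. it implies
`R̲⟨3,3,3⟩ ≤ 19` = the existing open item stmt-MatrixMultiplication-8008 (window `[17, 20]`).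
[cite: Smirnov2013, Table 4] -/
theorem cubeNineteen_of_step_cell_three_two
    (h : algBorderRank (matMulTensor ℂ 3 3 (2 + 1)) + 1 ≤ algBorderRank (matMulTensor ℂ 3 3 2) + 2 * 3) :
    Summit.MatrixMultiplication.MatrixMultiplication.Theses.MarginalColumns.CubeNineteen := by
  unfold Summit.MatrixMultiplication.MatrixMultiplication.Theses.MarginalColumns.CubeNineteen
  have h14 : algBorderRank (matMulTensor ℂ 3 3 2) ≤ 14 := Smirnov2013_algBorderRank_matMulTensor_332_le ℂ
  simp only [Nat.reduceAdd] at h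
  omega

/-- **Conversely, `CubeNineteen` with the printed `R̲⟨2,3,3⟩ = 14` (CHL 2023 Thm 1.4, a named fact,
rotated to `R̲⟨3,3,2⟩`) gives the step cell `(3, 2)`:** `19 + 1 ≤ 14 + 6`. So modulo CHL Thm 1.4 the
cell `(3,2)` of the step stub IS stmt-MatrixMultiplication-8008.
[cite: ConnerHarperLandsberg2023, Thm. 1.4] -/
theorem step_cell_three_two_of_cubeNineteen (h14 : ConnerHarperLandsberg2023_thm_1_4_233)
    (h19 : Summit.MatrixMultiplication.MatrixMultiplication.Theses.MarginalColumns.CubeNineteen) :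
    algBorderRank (matMulTensor ℂ 3 3 (2 + 1)) + 1 ≤ algBorderRank (matMulTensor ℂ 3 3 2) + 2 * 3 := by
  unfold Summit.MatrixMultiplication.MatrixMultiplication.Theses.MarginalColumns.CubeNineteen at h19
  unfold ConnerHarperLandsberg2023_thm_1_4_233 at h14
  have hrot : algBorderRank (matMulTensor ℂ 3 3 2) = algBorderRank (matMulTensor ℂ 2 3 3) := by
    rw [algBorderRank_matMulTensor_rotate, algBorderRank_matMulTensor_rotate]
  simp only [Nat.reduceAdd]
  omega

end Summit.MatrixMultiplication.MatrixMultiplication.Cruxes.SecondColumnDominates.Sketch
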